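import Summits.CriticalPhenomena.PercolationContinuityZ3.Theorems.PercNearOneGluingNoHeavyLowerTailSahiCTCRtThreeSlots
import Summits.CriticalPhenomena.PercolationContinuityZ3.Theorems.PercNearOneGluingNoHeavyLowerTailSahiCTCKleitmanPivotCreditsAf
import HarnessLib

/-!
# `NoHeavyLowerTail` (crux stmt-CriticalPhenomena-4575), P3 lane: the squarefree row of `R_3 ∈ ℕ[s]` follows from an ASSIGNMENT of one point to
# every small non-member set (memo g48 §4d: ROW 0 ⟸ (F-ASSIGN))

Support file (seat `prim-l12-p3`, gen 48; `--supports stmt-CriticalPhenomena-4575`).  Memo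
`run/shared/lean/prim/prim-l12/FROM-prim-l12-p3-g48-THREE-BLOCK-SLOTS.md` §4d.

Refinement of `coeff_ind_Rt_three_nonneg_of_cslots` (…SahiCTCRtThreeSlots): choose for every small common non-member `R ⊆ V` a point `f R ∈ V ∖ R`.
Lemma A-f (`card_badEdges_avoiding_add_pivotSets_le_kap`, …SahiCTCKleitmanPivotCreditsAf) pays at the slot `R` all common edges of `V ∖ R` with
non-common co-set AND all common edges through `f R` (`card_badOrAt_le_kap` below).  Booking the nested pairs `(R, c)` with common co-set at `R`
whenever `f R ∈ c` leaves for the slot of the common edge `c` only the pairs with `f R ∉ c`: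
* **`card_badOrAt_le_kap`** : loop-free traces, `f ∈ s`: `#{common edges c ⊆ s : co-set not common ∨ f ∈ c} ≤ kap`;
* **`coeff_ind_Rt_three_nonneg_of_assignment`** : if for every common edge `c ⊆ V`
  `#{R ⊆ V∖c small non-member : V∖(c∪R) common, f R ∉ c} ≤ κ(∅, V∖c) + #(edge-sided crossings of V∖c)`, then `[s^V] R_3(𝒳,𝒵) ≥ 0`.
The remaining combinatorial statement (F-ASSIGN) — such an `f` always exists — is open (memo §4d: it exists in every tested instance).
Nothing is asserted about the crux.
-/

noncomputable section

open scoped Classical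

namespace Summit.CriticalPhenomena.PercolationContinuityZ3.Theorems.SahiCTCForms

open Finset MvPolynomial SahiCTCGenFun

variable {α : Type*} [DecidableEq α] [Fintype α]

/-! ### An r-slot pays its bad edges and every edge through the chosen point -/

omit [Fintype α] in
/-- **Lemma A-f, edge form**: for loop-free traces on `(D, s)` and `f ∈ s`, the common edges whose co-set is not a common member OR which contain `f`
number at most `kap 𝒳 𝒵 D s` (each edge `{f, h}` is charged to the pivot set `{h}`). [this work] -/
theorem card_badOrAt_le_kap {F G : Finset (Finset α)} (hF : IsUpperSet (F : Set (Finset α))) (hG : IsUpperSet (G : Set (Finset α)))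
    (s D : Finset α) (f : α) (hDs : Disjoint D s) (hfs : f ∈ s) (hLX : ∀ u ∈ s, insert u D ∉ F) (hLZ : ∀ u ∈ s, insert u D ∉ G) :
    (#((s.powerset.filter fun c => #c = 2 ∧ D ∪ c ∈ F ∧ D ∪ c ∈ G).filter
        fun c => ¬ (D ∪ (s \ c) ∈ F ∧ D ∪ (s \ c) ∈ G) ∨ f ∈ c) : ℤ) ≤ kap F G D s := by
  set E := (s.powerset.filter fun c => #c = 2 ∧ D ∪ c ∈ F ∧ D ∪ c ∈ G).filter
    fun c => ¬ (D ∪ (s \ c) ∈ F ∧ D ∪ (s \ c) ∈ G) ∨ f ∈ c with hE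
  have hsplit := card_filter_add_card_filter_not (s := E) (fun c => f ∈ c)
  -- the part avoiding `f` is the set of bad edges avoiding `f`
  have h1 : #(E.filter fun c => ¬ f ∈ c) ≤ #(((s.powerset.filter fun c => #c = 2 ∧ D ∪ c ∈ F ∧ D ∪ c ∈ G).filter
      fun c => ¬ (D ∪ (s \ c) ∈ F ∧ D ∪ (s \ c) ∈ G)).filter fun c => f ∉ c) := by
    refine card_le_card fun c hc => ?_
    obtain ⟨hcE, hfc⟩ := mem_filter.1 hc
    obtain ⟨hcG, hor⟩ := mem_filter.1 hcE
    exact mem_filter.2 ⟨mem_filter.2 ⟨hcG, hor.resolve_right hfc⟩, hfc⟩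
  -- the part through `f` injects into the pivot sets of `f` via `c ↦ c.erase f`
  have h2 : #(E.filter fun c => f ∈ c) ≤
      #((s.erase f).powerset.filter fun T => D ∪ T ∉ F ∧ D ∪ T ∉ G ∧ D ∪ insert f T ∈ F ∧ D ∪ insert f T ∈ G) := by
    refine card_le_card_of_injOn (fun c => c.erase f) (fun c hc => ?_) (fun c hc c' hc' h => ?_)
    · dsimp only
      obtain ⟨hcE, hfc⟩ := mem_filter.1 (mem_coe.1 hc)
      obtain ⟨hcG, -⟩ := mem_filter.1 hcE
      obtain ⟨w, hws, hwf, hceq⟩ := exists_pair_of_mem_cubeCommonEdges hcG hfc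
      obtain ⟨hcs, -, hcX, hcZ⟩ := mem_cubeCommonEdges.1 hcG
      have hce : c.erase f = {w} := by rw [hceq]; exact pair_erase_left hwf
      refine mem_coe.2 (mem_pivotSets.2 ⟨fun x hx => mem_erase.2 ⟨(mem_erase.1 hx).1, hcs (mem_of_mem_erase hx)⟩, ?_, ?_, ?_, ?_⟩)
      · rw [hce, union_singleton_eq_insert]; exact hLX w hws
      · rw [hce, union_singleton_eq_insert]; exact hLZ w hws
      · rw [insert_erase hfc]; exact hcX
      · rw [insert_erase hfc]; exact hcZ
    · have h1 : f ∈ c := (mem_filter.1 (mem_coe.1 hc)).2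
      have h2 : f ∈ c' := (mem_filter.1 (mem_coe.1 hc')).2
      have h' : c.erase f = c'.erase f := h
      rw [← insert_erase h1, h', insert_erase h2]
  have hAf := card_badEdges_avoiding_add_pivotSets_le_kap hF hG (#s) s D f le_rfl hDs hfs hLX hLZ
  have hnat : #E ≤ #(((s.powerset.filter fun c => #c = 2 ∧ D ∪ c ∈ F ∧ D ∪ c ∈ G).filter
      fun c => ¬ (D ∪ (s \ c) ∈ F ∧ D ∪ (s \ c) ∈ G)).filter fun c => f ∉ c)
      + #((s.erase f).powerset.filter fun T => D ∪ T ∉ F ∧ D ∪ T ∉ G ∧ D ∪ insert f T ∈ F ∧ D ∪ insert f T ∈ G) := by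
    rw [← hsplit, add_comm]; exact Nat.add_le_add h1 h2
  have hint : (#E : ℤ) ≤ (#(((s.powerset.filter fun c => #c = 2 ∧ D ∪ c ∈ F ∧ D ∪ c ∈ G).filter
      fun c => ¬ (D ∪ (s \ c) ∈ F ∧ D ∪ (s \ c) ∈ G)).filter fun c => f ∉ c) : ℤ)
      + #((s.erase f).powerset.filter fun T => D ∪ T ∉ F ∧ D ∪ T ∉ G ∧ D ∪ insert f T ∈ F ∧ D ∪ insert f T ∈ G) := by
    exact_mod_cast hnat
  linarith

/-! ### The squarefree row from an assignment -/

section Assign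
variable {F G : Finset (Finset α)}

/-- **ROW 0 ⟸ (F-ASSIGN).**  For a loop-free pair of up-sets on `V` and a choice `f R ∈ V ∖ R` for every small common non-member `R ⊆ V`: if for every
common edge `c ⊆ V` the small common non-members `R ⊆ V∖c` with `V∖(c∪R)` common AND `f R ∉ c` are at most `κ(∅, V∖c)` plus the edge-sided
crossings of `V∖c`, then `[s^V] R_3(𝒳,𝒵) ≥ 0`. [this work] -/
theorem coeff_ind_Rt_three_nonneg_of_assignment (hF : IsUpperSet (F : Set (Finset α))) (hG : IsUpperSet (G : Set (Finset α))) (V : Finset α)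
    (h0F : ∅ ∉ F) (h1F : ∀ v ∈ V, ({v} : Finset α) ∉ F) (h1G : ∀ v ∈ V, ({v} : Finset α) ∉ G) (f : Finset α → α)
    (hf : ∀ R ∈ ((V.powerset.filter fun U => #U ≤ 2).filter fun U => ¬ U ∈ F).filter fun U => ¬ U ∈ G, f R ∈ V \ R)
    (hc : ∀ c ∈ ((V.powerset.filter fun U => #U ≤ 2).filter fun U => U ∈ F).filter fun U => U ∈ G,
      (#((V \ c).powerset.filter fun R => #R ≤ 2 ∧ R ∉ F ∧ R ∉ G ∧ (V \ c) \ R ∈ F ∧ (V \ c) \ R ∈ G ∧ f R ∉ c) : ℤ)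
        ≤ kap F G ∅ (V \ c)
          + #((V \ c).powerset.filter fun a => #a = 2 ∧ a ∈ F ∧ a ∉ G ∧ (V \ c) \ a ∈ G ∧ (V \ c) \ a ∉ F)
          + #((V \ c).powerset.filter fun b => #b = 2 ∧ b ∈ G ∧ b ∉ F ∧ (V \ c) \ b ∈ F ∧ (V \ c) \ b ∉ G)) :
    0 ≤ (Rt 3 F G).coeff (ind V) := by
  -- slots and their four types
  set slots := V.powerset.filter fun U => #U ≤ 2 with hslots
  set Cdom := (slots.filter fun U => U ∈ F).filter fun U => U ∈ G with hCdom
  set Adom := (slots.filter fun U => U ∈ F).filter fun U => ¬ U ∈ G with hAdom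
  set Bdom := (slots.filter fun U => ¬ U ∈ F).filter fun U => U ∈ G with hBdom
  set Rdom := (slots.filter fun U => ¬ U ∈ F).filter fun U => ¬ U ∈ G with hRdom
  have hsplit : ∑ U ∈ slots, kap F G ∅ (V \ U) =
      ∑ U ∈ Cdom, kap F G ∅ (V \ U) + ∑ U ∈ Adom, kap F G ∅ (V \ U) +
        (∑ U ∈ Bdom, kap F G ∅ (V \ U) + ∑ U ∈ Rdom, kap F G ∅ (V \ U)) := by
    rw [← sum_filter_add_sum_filter_not slots (fun U => U ∈ F), ← sum_filter_add_sum_filter_not (slots.filter fun U => U ∈ F) (fun U => U ∈ G),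
      ← sum_filter_add_sum_filter_not (slots.filter fun U => ¬ U ∈ F) (fun U => U ∈ G)]
  have hkap0 : ∀ U : Finset α, 0 ≤ kap F G ∅ (V \ U) := fun U => kap_nonneg hF hG _ _ (disjoint_empty_left _)
  -- loop-freeness on the cubes `V \ U`
  have hLX : ∀ (U : Finset α), ∀ u ∈ V \ U, insert u (∅ : Finset α) ∉ F := fun U u hu => by
    rw [insert_empty]; exact h1F u (mem_sdiff.1 hu).1
  have hLZ : ∀ (U : Finset α), ∀ u ∈ V \ U, insert u (∅ : Finset α) ∉ G := fun U u hu => by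
    rw [insert_empty]; exact h1G u (mem_sdiff.1 hu).1
  have hA := fun U : Finset α => card_cubeBadEdges_le_kap hF hG (#(V \ U)) (V \ U) ∅ le_rfl (disjoint_empty_left _) (hLX U) (hLZ U)
  have hAf := fun (R : Finset α) (hR : R ∈ Rdom) =>
    card_badOrAt_le_kap hF hG (V \ R) ∅ (f R) (disjoint_empty_left _) (hf R hR) (hLX R) (hLZ R)
  -- the nested small pairs
  set NSP := ((smallN F G) ×ˢ (smallY F G)).filter fun p => Disjoint p.1 p.2 ∧ p.1 ∪ p.2 ⊆ V with hNSP
  have hmemN : ∀ {S : Finset α}, S ∈ smallN F G ↔ #S < 3 ∧ S ∉ F ∧ S ∉ G := fun {S} => by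
    simp only [smallN, bySize, mem_filter, mem_powerset, subset_univ, true_and]
  have hmemY : ∀ {S : Finset α}, S ∈ smallY F G ↔ #S < 3 ∧ S ∈ F ∧ S ∈ G := fun {S} => by
    simp only [smallY, bySize, mem_filter, mem_powerset, subset_univ, true_and]
  have hNSPmem : ∀ {p : Finset α × Finset α}, p ∈ NSP →
      (#p.1 ≤ 2 ∧ p.1 ∉ F ∧ p.1 ∉ G) ∧ (#p.2 = 2 ∧ p.2 ∈ F ∧ p.2 ∈ G) ∧ Disjoint p.1 p.2 ∧ p.1 ⊆ V ∧ p.2 ⊆ V := by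
    intro p hp
    rw [hNSP, mem_filter, mem_product] at hp
    obtain ⟨⟨h1, h2⟩, hd, hu⟩ := hp
    obtain ⟨h1c, h1F', h1G'⟩ := hmemN.1 h1
    obtain ⟨h2c, h2F, h2G⟩ := hmemY.1 h2
    have h2V : p.2 ⊆ V := (subset_union_right).trans hu
    exact ⟨⟨by omega, h1F', h1G'⟩, ⟨card_eq_two_of_mem_of_card_le_two h0F h1F h2F h2V (by omega), h2F, h2G⟩, hd,
      (subset_union_left).trans hu, h2V⟩
  set NSPn := NSP.filter fun p => ¬ (V \ (p.1 ∪ p.2) ∈ F ∧ V \ (p.1 ∪ p.2) ∈ G) ∨ f p.1 ∈ p.2 with hNSPn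
  set NSPb := NSP.filter fun p => ¬ (¬ (V \ (p.1 ∪ p.2) ∈ F ∧ V \ (p.1 ∪ p.2) ∈ G) ∨ f p.1 ∈ p.2) with hNSPb
  have hNSPsplit : (#NSP : ℤ) = #NSPn + #NSPb := by
    rw [← card_filter_add_card_filter_not (s := NSP) (fun p => ¬ (V \ (p.1 ∪ p.2) ∈ F ∧ V \ (p.1 ∪ p.2) ∈ G) ∨ f p.1 ∈ p.2)]
    push_cast; rfl
  have hsd : ∀ {R c : Finset α}, Disjoint R c → V \ (R ∪ c) = (V \ c) \ R := fun {R c} _ => by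
    ext x; simp only [mem_sdiff, mem_union, not_or]; tauto
  have hsd' : ∀ {R c : Finset α}, Disjoint R c → V \ (R ∪ c) = (V \ R) \ c := fun {R c} _ => by
    ext x; simp only [mem_sdiff, mem_union, not_or]; tauto
  -- (1) the pairs booked at the r-slots (bad co-set, or through the chosen point `f R`) are paid by Lemma A-f there
  have hNSPn_le : (#NSPn : ℤ) ≤ ∑ R ∈ Rdom, kap F G ∅ (V \ R) := by
    have hmaps : Set.MapsTo (fun p : Finset α × Finset α => p.1) (NSPn : Finset (Finset α × Finset α)) (Rdom : Finset (Finset α)) := by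
      intro p hp
      obtain ⟨hpN, -⟩ := mem_filter.1 (mem_coe.1 hp)
      obtain ⟨⟨h1c, h1F', h1G'⟩, -, -, h1V, -⟩ := hNSPmem hpN
      exact mem_coe.2 (by
        rw [hRdom, mem_filter, mem_filter, hslots, mem_filter, mem_powerset]; exact ⟨⟨⟨h1V, h1c⟩, h1F'⟩, h1G'⟩)
    rw [card_eq_sum_card_fiberwise hmaps]
    push_cast
    refine sum_le_sum fun R hR => le_trans ?_ (hAf R hR)
    have key : #(NSPn.filter fun p => p.1 = R) ≤ #(((V \ R).powerset.filter fun c => #c = 2 ∧ ∅ ∪ c ∈ F ∧ ∅ ∪ c ∈ G).filter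
        fun c => ¬ (∅ ∪ ((V \ R) \ c) ∈ F ∧ ∅ ∪ ((V \ R) \ c) ∈ G) ∨ f R ∈ c) := by
      refine card_le_card_of_injOn (fun p : Finset α × Finset α => p.2) (fun p hp => ?_) (fun p hp p' hp' h => ?_)
      · obtain ⟨hpn, hpR⟩ := mem_filter.1 (mem_coe.1 hp)
        obtain ⟨hpN, hnb⟩ := mem_filter.1 hpn
        obtain ⟨-, ⟨h2c, h2F, h2G⟩, hd, -, h2V⟩ := hNSPmem hpN
        subst hpR
        refine mem_coe.2 (mem_filter.2 ⟨mem_filter.2 ⟨mem_powerset.2 fun x hx => mem_sdiff.2 ⟨h2V hx, fun h => disjoint_left.1 hd h hx⟩,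
          h2c, by rw [empty_union]; exact h2F, by rw [empty_union]; exact h2G⟩, ?_⟩)
        rw [empty_union, ← hsd' hd]; exact hnb
      · obtain ⟨-, hpR⟩ := mem_filter.1 (mem_coe.1 hp)
        obtain ⟨-, hpR'⟩ := mem_filter.1 (mem_coe.1 hp')
        exact Prod.ext (hpR.trans hpR'.symm) h
    exact_mod_cast key
  -- (2) the pairs booked at the c-slots are bounded by the c-slot hypothesis
  have hNSPb_le : (#NSPb : ℤ) ≤ ∑ c ∈ Cdom, (kap F G ∅ (V \ c)
      + #((V \ c).powerset.filter fun a => #a = 2 ∧ a ∈ F ∧ a ∉ G ∧ (V \ c) \ a ∈ G ∧ (V \ c) \ a ∉ F)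
      + #((V \ c).powerset.filter fun b => #b = 2 ∧ b ∈ G ∧ b ∉ F ∧ (V \ c) \ b ∈ F ∧ (V \ c) \ b ∉ G)) := by
    have hmaps : Set.MapsTo (fun p : Finset α × Finset α => p.2) (NSPb : Finset (Finset α × Finset α)) (Cdom : Finset (Finset α)) := by
      intro p hp
      obtain ⟨hpN, -⟩ := mem_filter.1 (mem_coe.1 hp)
      obtain ⟨-, ⟨h2c, h2F, h2G⟩, -, -, h2V⟩ := hNSPmem hpN
      exact mem_coe.2 (by
        rw [hCdom, mem_filter, mem_filter, hslots, mem_filter, mem_powerset]; exact ⟨⟨⟨h2V, h2c.le⟩, h2F⟩, h2G⟩)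
    rw [card_eq_sum_card_fiberwise hmaps]
    push_cast
    refine sum_le_sum fun c hcC => le_trans ?_ (hc c hcC)
    have key : #(NSPb.filter fun p => p.2 = c) ≤
        #((V \ c).powerset.filter fun R => #R ≤ 2 ∧ R ∉ F ∧ R ∉ G ∧ (V \ c) \ R ∈ F ∧ (V \ c) \ R ∈ G ∧ f R ∉ c) := by
      refine card_le_card_of_injOn (fun p : Finset α × Finset α => p.1) (fun p hp => ?_) (fun p hp p' hp' h => ?_)
      · obtain ⟨hpb, hpc⟩ := mem_filter.1 (mem_coe.1 hp)
        obtain ⟨hpN, hb⟩ := mem_filter.1 hpb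
        obtain ⟨⟨h1c, h1F', h1G'⟩, -, hd, h1V, -⟩ := hNSPmem hpN
        subst hpc
        have hboth : V \ (p.1 ∪ p.2) ∈ F ∧ V \ (p.1 ∪ p.2) ∈ G := by
          by_contra hnb; exact hb (Or.inl hnb)
        have hfnot : f p.1 ∉ p.2 := fun h => hb (Or.inr h)
        refine mem_coe.2 (mem_filter.2 ⟨mem_powerset.2 fun x hx => mem_sdiff.2 ⟨h1V hx, fun h => disjoint_left.1 hd hx h⟩,
          h1c, h1F', h1G', ?_, ?_, hfnot⟩) <;> rw [← hsd hd]
        · exact hboth.1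
        · exact hboth.2
      · obtain ⟨-, hpc⟩ := mem_filter.1 (mem_coe.1 hp)
        obtain ⟨-, hpc'⟩ := mem_filter.1 (mem_coe.1 hp')
        exact Prod.ext h (hpc.trans hpc'.symm)
    exact_mod_cast key
  -- (3) the moved edge-sided crossings are paid at the a-/b-slots by Lemma A there
  have hext : ∀ (P : Finset α → Prop) (Q : Finset α → Prop) (Edom : Finset (Finset α)),
      (∀ a, a ∈ Edom ↔ a ∈ slots ∧ P a) → (∀ a, P a → a ∈ F ∨ a ∈ G) →
      (∀ S, Q S → ¬ (S ∈ F ∧ S ∈ G)) →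
      ∑ c ∈ Cdom, (#((V \ c).powerset.filter fun a => #a = 2 ∧ P a ∧ Q ((V \ c) \ a)) : ℤ) ≤ ∑ a ∈ Edom, kap F G ∅ (V \ a) := by
    intro P Q Edom hE hPmem hQ
    -- the set of pairs (c, a)
    set PR := (Cdom ×ˢ Edom).filter fun p => Disjoint p.1 p.2 ∧ Q (V \ (p.1 ∪ p.2)) with hPR
    have h1 : ∑ c ∈ Cdom, (#((V \ c).powerset.filter fun a => #a = 2 ∧ P a ∧ Q ((V \ c) \ a)) : ℤ) ≤ #PR := by
      have hmaps : Set.MapsTo (fun p : Finset α × Finset α => p.1) (PR : Finset (Finset α × Finset α)) (Cdom : Finset (Finset α)) :=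
        fun p hp => mem_coe.2 (mem_product.1 (mem_filter.1 (mem_coe.1 hp)).1).1
      rw [card_eq_sum_card_fiberwise hmaps]
      push_cast
      refine sum_le_sum fun c hcC => ?_
      have key : #((V \ c).powerset.filter fun a => #a = 2 ∧ P a ∧ Q ((V \ c) \ a)) ≤ #(PR.filter fun p => p.1 = c) := by
        refine card_le_card_of_injOn (fun a : Finset α => (c, a)) (fun a ha => ?_) (fun a _ a' _ h => (Prod.ext_iff.1 h).2)
        obtain ⟨haV, ha2, hPa, hQa⟩ := mem_filter.1 (mem_coe.1 ha)
        have haV' := mem_powerset.1 haV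
        have hd : Disjoint c a := disjoint_left.2 fun x hxc hxa => (mem_sdiff.1 (haV' hxa)).2 hxc
        refine mem_coe.2 (mem_filter.2 ⟨mem_filter.2 ⟨mem_product.2 ⟨hcC, (hE a).2 ⟨?_, hPa⟩⟩, hd, ?_⟩, rfl⟩)
        · rw [hslots, mem_filter, mem_powerset]; exact ⟨fun x hx => (mem_sdiff.1 (haV' hx)).1, le_of_eq ha2⟩
        · rw [hsd' hd]; exact hQa
      exact_mod_cast key
    have h2 : (#PR : ℤ) ≤ ∑ a ∈ Edom, kap F G ∅ (V \ a) := by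
      have hmaps : Set.MapsTo (fun p : Finset α × Finset α => p.2) (PR : Finset (Finset α × Finset α)) (Edom : Finset (Finset α)) :=
        fun p hp => mem_coe.2 (mem_product.1 (mem_filter.1 (mem_coe.1 hp)).1).2
      rw [card_eq_sum_card_fiberwise hmaps]
      push_cast
      refine sum_le_sum fun a haE => le_trans ?_ (hA a)
      have key : #(PR.filter fun p => p.2 = a) ≤ #(((V \ a).powerset.filter fun c => #c = 2 ∧ ∅ ∪ c ∈ F ∧ ∅ ∪ c ∈ G).filter
          fun c => ¬ (∅ ∪ ((V \ a) \ c) ∈ F ∧ ∅ ∪ ((V \ a) \ c) ∈ G)) := by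
       refine card_le_card_of_injOn (fun p : Finset α × Finset α => p.1) (fun p hp => ?_) (fun p hp p' hp' h => ?_)
       · obtain ⟨hpPR, hpa⟩ := mem_filter.1 (mem_coe.1 hp)
         obtain ⟨hcd, hd, hQp⟩ := mem_filter.1 hpPR
         obtain ⟨hcC, -⟩ := mem_product.1 hcd
         subst hpa
         obtain ⟨⟨hcs, hcF⟩, hcG⟩ : (p.1 ∈ slots ∧ p.1 ∈ F) ∧ p.1 ∈ G := by
           rw [hCdom, mem_filter, mem_filter] at hcC; exact hcC
         obtain ⟨hcV, hc2⟩ := mem_filter.1 hcs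
         have hcV' := mem_powerset.1 hcV
         refine mem_coe.2 (mem_filter.2 ⟨mem_filter.2 ⟨mem_powerset.2 fun x hx => mem_sdiff.2 ⟨hcV' hx, fun h => disjoint_left.1 hd hx h⟩,
           card_eq_two_of_mem_of_card_le_two h0F h1F hcF hcV' hc2, by rw [empty_union]; exact hcF, by rw [empty_union]; exact hcG⟩, ?_⟩)
         rw [empty_union, ← hsd hd]; exact hQ _ hQp
       · obtain ⟨-, hpa⟩ := mem_filter.1 (mem_coe.1 hp)
         obtain ⟨-, hpa'⟩ := mem_filter.1 (mem_coe.1 hp')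
         exact Prod.ext h (hpa.trans hpa'.symm)
      exact_mod_cast key
    exact h1.trans h2
  have hext1 : ∑ c ∈ Cdom, (#((V \ c).powerset.filter fun a => #a = 2 ∧ a ∈ F ∧ a ∉ G ∧ (V \ c) \ a ∈ G ∧ (V \ c) \ a ∉ F) : ℤ)
      ≤ ∑ a ∈ Adom, kap F G ∅ (V \ a) := by
    have h := hext (fun a => a ∈ F ∧ a ∉ G) (fun S => S ∈ G ∧ S ∉ F) Adom
      (fun a => by rw [hAdom, mem_filter, mem_filter, and_assoc]) (fun a h => Or.inl h.1) (fun S h h' => h.2 h'.1)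
    simpa only [and_assoc] using h
  have hext2 : ∑ c ∈ Cdom, (#((V \ c).powerset.filter fun b => #b = 2 ∧ b ∈ G ∧ b ∉ F ∧ (V \ c) \ b ∈ F ∧ (V \ c) \ b ∉ G) : ℤ)
      ≤ ∑ b ∈ Bdom, kap F G ∅ (V \ b) := by
    have h := hext (fun b => b ∈ G ∧ b ∉ F) (fun S => S ∈ F ∧ S ∉ G) Bdom
      (fun b => by rw [hBdom, mem_filter, mem_filter, and_assoc]; tauto) (fun b h => Or.inr h.1) (fun S h h' => h.2 h'.2)
    simpa only [and_assoc] using h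
  -- assemble
  refine coeff_ind_Rt_three_nonneg_of_le F G V ?_
  have hcross : (0 : ℤ) ≤ ∑ S ∈ V.powerset, (pairsAt (smallXo F G) (smallZo F G) (V \ S) : ℤ) :=
    sum_nonneg fun S _ => Nat.cast_nonneg _
  have hnsp : ∑ S ∈ V.powerset, (pairsAt (smallN F G) (smallY F G) (V \ S) : ℤ) = #NSP := sum_pairsAt_eq_card _ _ V
  rw [hnsp, hNSPsplit, hsplit]
  rw [sum_add_distrib, sum_add_distrib] at hNSPb_le
  linarith [hNSPn_le, hNSPb_le, hext1, hext2, hcross]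

end Assign

end Summit.CriticalPhenomena.PercolationContinuityZ3.Theorems.SahiCTCForms
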